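import Mathlib
import Summits.Ventures.PercRepro2.Defs
import Summits.Ventures.PercRepro2.Graph
import Summits.Ventures.PercRepro2.HullDefs
import Summits.Ventures.PercRepro2.LocRows
import Summits.Ventures.PercRepro2.SwRow
import Summits.Ventures.PercRepro2.SwGlue
import Summits.Ventures.PercRepro2.SwAllRow
import Summits.Ventures.PercRepro2.RigidLemma
import Summits.Ventures.PercRepro2.SwAllBlocks

/-!
# Row 2′SW-ALL across a cut vertex: the placements `c = o` and `o ∣ {l, h}` (blind cell PercRepro2,
night-4 g5, 2026-08-24; proofs/NIGHT4-BRIDGE.md §11)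

* `swAll_glue_cut_o` — `c = o` (no hypothesis: the rigid lemma `Rigid.exists_rigidPerm_of_isLowerSet`
  on the decreasing class `{h ∉ C_R(o)}` of the `h`-side);
* `swAll_glue_sep_o` — `c` separating `o` from `{l, h}` (2′SW-ALL(G₂; l, h, c) ⟹ 2′SW-ALL(G)): the
  rigid permutation of the second side on the class `{c ∈ R_side(l)}`, its colour swap on `{c ∈ K(l)}`.
The two placements with a mark on each side next to `c` (`{l, o} ∣ h` and `l ∣ {h, o}`) need the rigid
side injection and the rigid one-sided domination (§11) and are not in these files.
-/

namespace Summit.Ventures.PercRepro2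

namespace Glue

open Hull LocRows Rigid

open scoped Classical

variable {V : Type*} {E₁ E₂ : Type*}
variable {ends₁ : E₁ → Sym2 V} {ends₂ : E₂ → Sym2 V} {c : V} {V₁ V₂ : Set V}

/-- The red cluster of `h` lives on the second side when the cut vertex is not in it. -/
lemma cluster_glue_eq₂_of_not_mem (hg : IsGluing ends₁ ends₂ c V₁ V₂) {ζ : Config (E₁ ⊕ E₂)} {h : V}
    (hh : h ∈ V₂) (hc : c ∉ cluster ends₂ (ζ ∘ Sum.inr) h) :
    cluster (glue ends₁ ends₂) ζ h = cluster ends₂ (ζ ∘ Sum.inr) h := by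
  rw [cluster_glue_eq₂ hg hh]
  ext x
  simp only [Set.mem_union, Set.mem_setOf_eq]
  constructor
  · rintro (hx | ⟨hc', _⟩)
    · exact hx
    · exact absurd hc' hc
  · exact Or.inl

/-- No first-side edge lies inside a set contained in `V₂ ∖ {c}`. -/
lemma not_mem_within_inl (hg : IsGluing ends₁ ends₂ c V₁ V₂) {S : Set V} (hS : S ⊆ V₂)
    (hcS : c ∉ S) {e : E₁} (he : Sum.inl e ∈ within (glue ends₁ ends₂) S) : False := by
  obtain ⟨a, ⟨ha, haV₁⟩, _, _, _⟩ := mem_within_inl_glue hg he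
  have hac : a = c := hg.inter a haV₁ (hS ha)
  rw [hac] at ha
  exact hcS ha

variable [Fintype E₁] [Fintype E₂] [DecidableEq E₁] [DecidableEq E₂]

/-- The decreasing class `{h ∉ C_R(o)}` of the second side. -/
noncomputable def avoidClass (ends₂ : E₂ → Sym2 V) (o h : V) : Finset (Config E₂) :=
  Finset.univ.filter fun ζ₂ => h ∉ cluster ends₂ ζ₂ o

/-- `avoidClass` is decreasing. -/
lemma isLowerSet_avoidClass (o h : V) :
    IsLowerSet (↑(avoidClass ends₂ o h) : Set (Config E₂)) := by
  intro ζ' ζ hle hζ'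
  simp only [Finset.mem_coe, avoidClass, Finset.mem_filter, Finset.mem_univ, true_and] at hζ' ⊢
  exact fun hc => hζ' (cluster_mono hle o hc)

/-- The red edges of the red cluster of `h` on the second side. -/
noncomputable def hRed (ends₂ : E₂ → Sym2 V) (h : V) (ζ₂ : Config E₂) : Finset E₂ :=
  Finset.univ.filter fun e => e ∈ within ends₂ (cluster ends₂ ζ₂ h) ∧ ζ₂ e = true

omit [DecidableEq E₂] in
/-- `hRed` consists of red edges. -/
lemma hRed_subset (h : V) (ζ₂ : Config E₂) : hRed ends₂ h ζ₂ ⊆ redF ζ₂ := by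
  intro e he
  simp only [hRed, Finset.mem_filter, Finset.mem_univ, true_and] at he
  exact mem_redF.2 he.2

omit [DecidableEq E₂] in
/-- `hRed` is monotone. -/
lemma hRed_mono (h : V) {ζ ζ' : Config E₂} (hle : ζ ≤ ζ') : hRed ends₂ h ζ ⊆ hRed ends₂ h ζ' := by
  intro e he
  simp only [hRed, Finset.mem_filter, Finset.mem_univ, true_and] at he ⊢
  obtain ⟨⟨x, hx, y, hy, hends⟩, hred⟩ := he
  refine ⟨⟨x, cluster_mono hle h hx, y, cluster_mono hle h hy, hends⟩, ?_⟩
  have := hle e; rw [hred] at this; exact Bool.le_iff_imp.1 this rfl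

/-- **2′SW-ALL across a cut at `o`** (`c = o`, `l` on the first side, `h` on the second): the rigid
lemma on the decreasing class `{h ∉ C_R(o)}` of the `h`-side. -/
theorem swAll_glue_cut_o {l h o : V} (hg : IsGluing ends₁ ends₂ o V₁ V₂) (hl : l ∈ V₁)
    (hh : h ∈ V₂) (hho : h ≠ o) : SwAll (glue ends₁ ends₂) l h o := by
  obtain ⟨θ, hθ, hmθ⟩ := exists_rigidPerm_of_isLowerSet (avoidClass ends₂ o h)
    (isLowerSet_avoidClass o h) (hRed ends₂ h) (hRed_subset h) (fun _ _ hle => hRed_mono h hle)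
  -- `Q` of the glued graph
  have hmem_o : ∀ ζ : Config (E₁ ⊕ E₂),
      o ∈ cluster (glue ends₁ ends₂) ζ l ↔ o ∈ cluster ends₁ (ζ ∘ Sum.inl) l := by
    intro ζ
    rw [cluster_glue_eq hg hl]
    simp only [Set.mem_union, Set.mem_setOf_eq]
    constructor
    · rintro (h' | ⟨h', _⟩) <;> exact h'
    · exact Or.inl
  have key : ∀ ζ : Config (E₁ ⊕ E₂),
      ζ ∈ tgtU (glue ends₁ ends₂) l h {S : Set V | o ∈ S} ↔
        (o ∈ cluster ends₁ (ζ ∘ Sum.inl) l ∧ o ∉ cluster ends₁ (blue (ζ ∘ Sum.inl)) l) ∧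
          ζ ∘ Sum.inr ∈ avoidClass ends₂ o h := by
    intro ζ
    rw [mem_tgtU_glue_iff, mem_cluster_glue_iff_across hg hl hh hho,
      mem_cluster_glue_iff_across hg hl hh hho, hmem_o, hmem_o, blue_comp_inl, blue_comp_inr]
    simp only [avoidClass, Finset.mem_filter, Finset.mem_univ, true_and, not_and]
    constructor
    · rintro ⟨⟨h1, _⟩, h3, h4⟩
      exact ⟨⟨h3, h4⟩, h1 h3⟩
    · rintro ⟨⟨h3, h4⟩, h1⟩
      exact ⟨⟨fun _ => h1, fun h' => absurd h' h4⟩, h3, h4⟩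
  refine ⟨fun x => pair (x.1 ∘ Sum.inl) (θ ⟨x.1 ∘ Sum.inr, ((key _).1 x.2).2⟩), ?_, ?_⟩
  · intro x y hxy
    have h1 := congrArg (fun ζ => ζ ∘ Sum.inl) hxy
    have h2 := congrArg (fun ζ => ζ ∘ Sum.inr) hxy
    simp only [pair_inl, pair_inr] at h1 h2
    have h2' : x.1 ∘ Sum.inr = y.1 ∘ Sum.inr := congrArg Subtype.val (hθ h2)
    apply Subtype.ext
    rw [← pair_comp x.1, ← pair_comp y.1, h1, h2']
  · intro x
    obtain ⟨hx₁, hx₂⟩ := (key x.1).1 x.2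
    obtain ⟨hmem, hflip⟩ := hmθ ⟨x.1 ∘ Sum.inr, hx₂⟩
    refine ⟨(key _).2 ⟨by rw [pair_inl]; exact hx₁, by rw [pair_inr]; exact hmem⟩, ?_⟩
    -- the red cluster of `h` lives on the second side
    have hco : o ∉ cluster ends₂ (x.1 ∘ Sum.inr) h := by
      intro hc
      simp only [avoidClass, Finset.mem_filter, Finset.mem_univ, true_and] at hx₂
      exact hx₂ (mem_cluster_comm.1 hc)
    have hT := cluster_glue_eq₂_of_not_mem hg hh hco
    intro e he hred
    rw [hT] at he
    rcases e with e₁ | e₂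
    · exact (not_mem_within_inl hg (cluster_subset_of_mem₂ hg hh) hco he).elim
    · show θ ⟨x.1 ∘ Sum.inr, hx₂⟩ e₂ = false
      apply hflip
      simp only [hRed, Finset.mem_filter, Finset.mem_univ, true_and]
      exact ⟨he, hred⟩

/-- **2′SW-ALL across a cut separating `o` from `{l, h}`**: 2′SW-ALL(G₂; l, h, c) ⟹ 2′SW-ALL(G). -/
theorem swAll_glue_sep_o {l h o : V} (hg : IsGluing ends₁ ends₂ c V₁ V₂) (ho : o ∈ V₁) (hoc : o ≠ c)
    (hl : l ∈ V₂) (hh : h ∈ V₂) (hhc : h ≠ c) (h₂ : SwAll ends₂ l h c) :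
    SwAll (glue ends₁ ends₂) l h o := by
  obtain ⟨f₂, hf₂, hmem₂⟩ := h₂
  have hoV₂ : o ∉ V₂ := fun h' => hoc (hg.inter o ho h')
  -- membership of `o` in the cluster of `l`: through `c`
  have hmem_o : ∀ ζ : Config (E₁ ⊕ E₂),
      o ∈ cluster (glue ends₁ ends₂) ζ l ↔
        c ∈ cluster ends₂ (ζ ∘ Sum.inr) l ∧ o ∈ cluster ends₁ (ζ ∘ Sum.inl) c := by
    intro ζ
    rw [cluster_glue_eq₂ hg hl]
    simp only [Set.mem_union, Set.mem_setOf_eq]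
    constructor
    · rintro (h' | h')
      · exact absurd (cluster_subset_of_mem₂ hg hl h') hoV₂
      · exact h'
    · exact Or.inr
  have key : ∀ ζ : Config (E₁ ⊕ E₂),
      ζ ∈ tgtU (glue ends₁ ends₂) l h {S : Set V | o ∈ S} ↔
        (h ∉ cluster ends₂ (ζ ∘ Sum.inr) l ∧ h ∉ cluster ends₂ (blue (ζ ∘ Sum.inr)) l) ∧
          (c ∈ cluster ends₂ (ζ ∘ Sum.inr) l ∧ o ∈ cluster ends₁ (ζ ∘ Sum.inl) c) ∧
          ¬ (c ∈ cluster ends₂ (blue (ζ ∘ Sum.inr)) l ∧ o ∈ cluster ends₁ (blue (ζ ∘ Sum.inl)) c) := by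
    intro ζ
    rw [mem_tgtU_glue_iff, mem_cluster_glue_iff₂ hg hl hh hhc, mem_cluster_glue_iff₂ hg hl hh hhc,
      hmem_o, hmem_o, blue_comp_inl, blue_comp_inr]
  -- the map: the swap of the `h`-side on the core class, the rigid permutation of `G₂` otherwise
  let Φ : {ζ // ζ ∈ tgtU (glue ends₁ ends₂) l h {S : Set V | o ∈ S}} → Config (E₁ ⊕ E₂) := fun x =>
    if hK : c ∈ cluster ends₂ (blue (x.1 ∘ Sum.inr)) l then pair (x.1 ∘ Sum.inl) (blue (x.1 ∘ Sum.inr))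
    else pair (x.1 ∘ Sum.inl) (f₂ ⟨x.1 ∘ Sum.inr, by
      have hx := (key _).1 x.2
      simp only [tgtU, Finset.mem_filter, Finset.mem_univ, true_and, mem_hull_iff, Set.mem_setOf_eq,
        not_or]
      exact ⟨hx.1, hx.2.1.1, hK⟩⟩)
  -- the second-side membership of the `R`-class image
  have himgR : ∀ (x : {ζ // ζ ∈ tgtU (glue ends₁ ends₂) l h {S : Set V | o ∈ S}})
      (hK : ¬ c ∈ cluster ends₂ (blue (x.1 ∘ Sum.inr)) l),
      f₂ ⟨x.1 ∘ Sum.inr, by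
        have hx := (key _).1 x.2
        simp only [tgtU, Finset.mem_filter, Finset.mem_univ, true_and, mem_hull_iff, Set.mem_setOf_eq,
          not_or]
        exact ⟨hx.1, hx.2.1.1, hK⟩⟩ ∈ tgtU ends₂ l h {S : Set V | c ∈ S} := fun x hK => (hmem₂ _).1
  refine ⟨Φ, ?_, ?_⟩
  · intro x y hxy
    have hxy' : Φ x = Φ y := hxy
    by_cases hKx : c ∈ cluster ends₂ (blue (x.1 ∘ Sum.inr)) l <;>
      by_cases hKy : c ∈ cluster ends₂ (blue (y.1 ∘ Sum.inr)) l
    · simp only [Φ, dif_pos hKx, dif_pos hKy] at hxy'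
      have h1 := congrArg (fun ζ => ζ ∘ Sum.inl) hxy'
      have h2 := congrArg (fun ζ => ζ ∘ Sum.inr) hxy'
      simp only [pair_inl, pair_inr] at h1 h2
      have h2' : x.1 ∘ Sum.inr = y.1 ∘ Sum.inr := by
        have := congrArg blue h2; simpa only [blue_blue] using this
      apply Subtype.ext
      rw [← pair_comp x.1, ← pair_comp y.1, h1, h2']
    · exfalso
      simp only [Φ, dif_pos hKx, dif_neg hKy] at hxy'
      have h2 := congrArg (fun ζ => ζ ∘ Sum.inr) hxy'
      simp only [pair_inr] at h2
      -- the `K`-class image has `c` in the blue cluster of `l`, the `R`-class image does not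
      have hy' := himgR y hKy
      simp only [tgtU, Finset.mem_filter, Finset.mem_univ, true_and, mem_hull_iff, Set.mem_setOf_eq,
        not_or] at hy'
      have hcx : c ∈ cluster ends₂ (blue (blue (x.1 ∘ Sum.inr))) l := by
        rw [blue_blue]; exact ((key _).1 x.2).2.1.1
      rw [h2] at hcx
      exact hy'.2.2 hcx
    · exfalso
      simp only [Φ, dif_neg hKx, dif_pos hKy] at hxy'
      have h2 := congrArg (fun ζ => ζ ∘ Sum.inr) hxy'
      simp only [pair_inr] at h2
      have hx' := himgR x hKx
      simp only [tgtU, Finset.mem_filter, Finset.mem_univ, true_and, mem_hull_iff, Set.mem_setOf_eq,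
        not_or] at hx'
      have hcy : c ∈ cluster ends₂ (blue (blue (y.1 ∘ Sum.inr))) l := by
        rw [blue_blue]; exact ((key _).1 y.2).2.1.1
      rw [← h2] at hcy
      exact hx'.2.2 hcy
    · simp only [Φ, dif_neg hKx, dif_neg hKy] at hxy'
      have h1 := congrArg (fun ζ => ζ ∘ Sum.inl) hxy'
      have h2 := congrArg (fun ζ => ζ ∘ Sum.inr) hxy'
      simp only [pair_inl, pair_inr] at h1 h2
      have h2' : x.1 ∘ Sum.inr = y.1 ∘ Sum.inr := congrArg Subtype.val (hf₂ h2)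
      apply Subtype.ext
      rw [← pair_comp x.1, ← pair_comp y.1, h1, h2']
  · intro x
    have hx := (key x.1).1 x.2
    -- the red cluster of `h` lives on the second side
    have hch : c ∉ cluster ends₂ (x.1 ∘ Sum.inr) h := by
      intro hc
      apply hx.1.1
      exact mem_of_conn_of_closed (ends := ends₂) (ω := x.1 ∘ Sum.inr)
        (S := cluster ends₂ (x.1 ∘ Sum.inr) l) (fun p hp q hpq => mem_cluster_of_adj hp hpq)
        hx.2.1.1 (mem_cluster_comm.1 hc)
    have hT := cluster_glue_eq₂_of_not_mem hg hh hch
    by_cases hK : c ∈ cluster ends₂ (blue (x.1 ∘ Sum.inr)) l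
    · have hΦ : Φ x = pair (x.1 ∘ Sum.inl) (blue (x.1 ∘ Sum.inr)) := by simp only [Φ, dif_pos hK]
      rw [hΦ]
      refine ⟨(key _).2 ?_, ?_⟩
      · rw [pair_inl, pair_inr, blue_blue]
        refine ⟨⟨hx.1.2, hx.1.1⟩, ⟨hK, hx.2.1.2⟩, ?_⟩
        rintro ⟨_, ho'⟩
        exact hx.2.2 ⟨hK, ho'⟩
      · intro e he hred
        rw [hT] at he
        rcases e with e₁ | e₂
        · exact (not_mem_within_inl hg (cluster_subset_of_mem₂ hg hh) hch he).elim
        · show blue (x.1 ∘ Sum.inr) e₂ = false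
          rw [blue_apply]; have : (x.1 ∘ Sum.inr) e₂ = true := hred; rw [this]; rfl
    · have hx₂ : x.1 ∘ Sum.inr ∈ tgtU ends₂ l h {S : Set V | c ∈ S} := by
        simp only [tgtU, Finset.mem_filter, Finset.mem_univ, true_and, mem_hull_iff, Set.mem_setOf_eq,
          not_or]
        exact ⟨hx.1, hx.2.1.1, hK⟩
      have hΦ : Φ x = pair (x.1 ∘ Sum.inl) (f₂ ⟨x.1 ∘ Sum.inr, hx₂⟩) := by simp only [Φ, dif_neg hK]
      rw [hΦ]
      obtain ⟨hmem', hflip⟩ := hmem₂ ⟨x.1 ∘ Sum.inr, hx₂⟩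
      simp only [tgtU, Finset.mem_filter, Finset.mem_univ, true_and, mem_hull_iff, Set.mem_setOf_eq,
        not_or] at hmem'
      refine ⟨(key _).2 ?_, ?_⟩
      · rw [pair_inl, pair_inr]
        exact ⟨hmem'.1, ⟨hmem'.2.1, hx.2.1.2⟩, fun h' => hmem'.2.2 h'.1⟩
      · intro e he hred
        rw [hT] at he
        rcases e with e₁ | e₂
        · exact (not_mem_within_inl hg (cluster_subset_of_mem₂ hg hh) hch he).elim
        · show f₂ ⟨x.1 ∘ Sum.inr, hx₂⟩ e₂ = false
          exact hflip e₂ he hred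

end Glue

end Summit.Ventures.PercRepro2
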